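import Literature.MathematicalPhysics.KineticTheory.DiPernaLionsDataApproximationLemmas
import Literature.Analysis.FluidPDE.SphereMeasureSymmetry
import Literature.Analysis.FunctionSpaces.SmoothParametricIntegral
import HarnessLib

/-!
# Smoothing of collision kernels on `E × S^{d-1}` (CIP 1994 §5.3 Step 7, the regularisation `qₙ`)

Topic: MathematicalPhysics / KineticTheory. First of the files proving the named fact
`kernel_approximation` (`DiPernaLionsScheme.lean`; CIP 1994 §5.3 Step 7 (i): "let
`qₙ ∈ C_0^∞(ℝ^d × S^{d-1})` satisfy (3.12) uniformly and `qₙ → q` a.e.", asserted without proof).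
This file supplies the analytic smoothing step for a bounded, compactly supported kernel on
`E × S^{d-1}` with respect to `dz dσ`, `σ = sphereMeasure = volume.toSphere`, in a form producing a
smooth function on the ambient `E × E` (as required by `IsSmoothTruncatedKernel`). Everything is
proved; the file declares theorems only.

* `lintegral_eq_lintegral_sphereMeasure_radial`: polar coordinates
  `∫ F = ∫_{S^{d-1}} ∫_0^∞ r^{d-1} F(rω) dr dσ` in a finite-dimensional inner product space
  (Mathlib's `measurePreserving_homeomorphUnitSphereProd`); `lintegral_sphere_shell_le`: the shell
  `1/2 < r < 2` part is bounded by `∫ F`.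
* `exists_measurable_radialProj`: a measurable `π : E → S^{d-1}` with `π(rω) = ω`.
* `exists_smooth_angular_approx`: for `0 ≤ H ≤ M` measurable on `E × S^{d-1}` with `H = 0` for
  `|z| > R₀`, and `η > 0`, a smooth `0 ≤ b ≤ max M 1 + 1` on `E × E`, vanishing for
  `|z| ≥ max R₀ 2 + 1`, with `∫∫ |b(z,ω) - H(z,ω)| dz dσ ≤ η`. Construction: extend `H` along rays
  to the shell `1/2 ≤ |y| ≤ 2`, smooth it in `L¹(dz dy)` (`exists_smooth_nonneg_approx`), and
  average back radially with the weight `r^{d-1}` (`contDiff_parametric_intervalIntegral`); the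
  error is controlled by polar coordinates.

## References

* C. Cercignani, R. Illner, M. Pulvirenti, *The Mathematical Theory of Dilute Gases*, Springer
  (1994), §5.3 Step 7, p. 146.
* R. J. DiPerna, P.-L. Lions, Ann. of Math. 130 (1989), §V (approximation of the kernel).
-/

open MeasureTheory Metric Real Set Filter Topology
open scoped ENNReal NNReal

noncomputable section

namespace Literature.MathematicalPhysics.KineticTheory

open Literature.Analysis.FluidPDE Literature.Analysis.FunctionSpaces

variable {E : Type*} [NormedAddCommGroup E] [InnerProductSpace ℝ E] [FiniteDimensional ℝ E]
  [MeasurableSpace E] [BorelSpace E]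

/-! ## Polar coordinates -/

section Polar

/-- **Polar coordinates for the lower Lebesgue integral** in a finite-dimensional real inner
product space: `∫ F(x) dx = ∫_{S^{d-1}} ∫_0^∞ r^{d-1} F(rω) dr dσ(ω)`, `d = dim E`, with
`σ = sphereMeasure = volume.toSphere` (Mathlib's `measurePreserving_homeomorphUnitSphereProd`).
[folklore] -/
theorem lintegral_eq_lintegral_sphereMeasure_radial [Nontrivial E] {F : E → ℝ≥0∞} (hF : Measurable F) :
    ∫⁻ x, F x = ∫⁻ ω, (∫⁻ r in Ioi (0 : ℝ), ENNReal.ofReal (r ^ (Module.finrank ℝ E - 1)) * F (r • (ω : E)))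
      ∂(sphereMeasure : Measure (sphere (0 : E) 1)) := by
  have hmp := (volume : Measure E).measurePreserving_homeomorphUnitSphereProd
  set e := homeomorphUnitSphereProd E with he
  have hG : Measurable fun p : sphere (0 : E) 1 × Ioi (0 : ℝ) => F ((e.symm p : _) : E) :=
    hF.comp (measurable_subtype_coe.comp e.symm.measurable)
  calc ∫⁻ x, F x = ∫⁻ x in ({0}ᶜ : Set E), F x := by rw [restrict_compl_singleton]
    _ = ∫⁻ x : ({0}ᶜ : Set E), F x ∂(volume.comap Subtype.val) :=
        (lintegral_subtype_comap (measurableSet_singleton (0 : E)).compl F).symm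
    _ = ∫⁻ x : ({0}ᶜ : Set E), F ((e.symm (e x) : _) : E) ∂(volume.comap Subtype.val) := by
        simp only [Homeomorph.symm_apply_apply]
    _ = ∫⁻ p, F ((e.symm p : _) : E) ∂((sphereMeasure : Measure (sphere (0 : E) 1)).prod
          (Measure.volumeIoiPow (Module.finrank ℝ E - 1))) :=
        hmp.lintegral_comp_emb e.measurableEmbedding (fun p => F ((e.symm p : _) : E))
    _ = ∫⁻ ω, ∫⁻ r, F ((e.symm (ω, r) : _) : E) ∂(Measure.volumeIoiPow (Module.finrank ℝ E - 1))
          ∂(sphereMeasure : Measure (sphere (0 : E) 1)) :=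
        lintegral_prod _ hG.aemeasurable
    _ = _ := by
        refine lintegral_congr fun ω => ?_
        simp only [he, homeomorphUnitSphereProd_symm_apply_coe]
        have hm1 : Measurable fun r : Ioi (0 : ℝ) => ENNReal.ofReal ((r : ℝ) ^ (Module.finrank ℝ E - 1)) :=
          (measurable_subtype_coe.pow_const _).ennreal_ofReal
        have hm2 : Measurable fun r : Ioi (0 : ℝ) => F ((r : ℝ) • (ω : E)) :=
          hF.comp (measurable_subtype_coe.smul_const _)
        rw [Measure.volumeIoiPow, lintegral_withDensity_eq_lintegral_mul _ hm1 hm2,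
          ← lintegral_subtype_comap measurableSet_Ioi
            (fun r : ℝ => ENNReal.ofReal (r ^ (Module.finrank ℝ E - 1)) * F (r • (ω : E)))]
        rfl

/-- **The shell estimate for radial averages**: for measurable `G ≥ 0` on `E`,
`∫_{S^{d-1}} ∫_{1/2}^{2} r^{d-1} G(rω) dr dσ ≤ ∫_E G` (polar coordinates, dropping the
complement of the shell `1/2 < |y| < 2`). [folklore] -/
theorem lintegral_sphere_shell_le [Nontrivial E] {G : E → ℝ≥0∞} (hG : Measurable G) :
    ∫⁻ ω, (∫⁻ r in Ioo (1 / 2 : ℝ) 2, ENNReal.ofReal (r ^ (Module.finrank ℝ E - 1)) * G (r • (ω : E)))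
      ∂(sphereMeasure : Measure (sphere (0 : E) 1)) ≤ ∫⁻ x, G x := by
  rw [lintegral_eq_lintegral_sphereMeasure_radial hG]
  refine lintegral_mono fun ω => lintegral_mono_set fun r hr => ?_
  exact lt_trans (by norm_num) hr.1

end Polar

/-! ## The radial projection -/

section Projection

variable [Nontrivial E]

omit [FiniteDimensional ℝ E] in
/-- **A measurable radial projection**: there is a measurable `π : E → S^{d-1}` with
`π(rω) = ω` for `r > 0` (namely `y ↦ y/|y|` off the origin). [folklore] -/
theorem exists_measurable_radialProj :
    ∃ pr : E → sphere (0 : E) 1, Measurable pr ∧ ∀ (r : ℝ), 0 < r → ∀ ω : sphere (0 : E) 1, pr (r • (ω : E)) = ω := by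
  classical
  obtain ⟨ω₀⟩ : Nonempty (sphere (0 : E) 1) :=
    ⟨⟨((NormedSpace.sphere_nonempty (x := (0 : E)) (r := 1)).2 zero_le_one).some,
      ((NormedSpace.sphere_nonempty (x := (0 : E)) (r := 1)).2 zero_le_one).some_mem⟩⟩
  have hmem : ∀ {y : E}, y ≠ 0 → ‖y‖⁻¹ • y ∈ sphere (0 : E) 1 := fun {y} hy => by
    rw [mem_sphere_zero_iff_norm, norm_smul, norm_inv, norm_norm, inv_mul_cancel₀ (norm_ne_zero_iff.2 hy)]
  set pr : E → sphere (0 : E) 1 := fun y => if h : y = 0 then ω₀ else ⟨‖y‖⁻¹ • y, hmem h⟩ with hpr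
  have hπcoe : ∀ {y : E}, y ≠ 0 → (pr y : E) = ‖y‖⁻¹ • y := fun {y} hy => by
    simp only [hpr, dif_neg hy]
  refine ⟨pr, ?_, ?_⟩
  · refine measurable_of_measurable_on_compl_singleton (0 : E) ?_
    set g : {x : E | x ≠ 0} → sphere (0 : E) 1 := fun x => ⟨‖(x : E)‖⁻¹ • (x : E), hmem x.2⟩ with hg
    have hgc : Continuous g :=
      Continuous.subtype_mk
        ((continuous_subtype_val.norm.inv₀ fun x => norm_ne_zero_iff.2 x.2).smul continuous_subtype_val) _
    have heq : {x : E | x ≠ 0}.restrict pr = g := by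
      funext x
      ext1
      simp only [restrict_apply, hg, hπcoe x.2]
    rw [heq]
    exact hgc.measurable
  · intro r hr ω
    have hω : ‖(ω : E)‖ = 1 := norm_eq_of_mem_sphere ω
    have hne : r • (ω : E) ≠ 0 := by
      rw [Ne, smul_eq_zero, not_or]
      exact ⟨hr.ne', fun h => by simp [h] at hω⟩
    ext1
    rw [hπcoe hne, norm_smul, Real.norm_eq_abs, abs_of_pos hr, hω, mul_one, smul_smul,
      inv_mul_cancel₀ hr.ne', one_smul]

end Projection

/-! ## Smoothing in the angular variable -/

section Smoothing

variable [Nontrivial E]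

/-- The radial weight `∫_{1/2}^{2} r^{k} dr` of the shell `1/2 ≤ |y| ≤ 2` is positive. [folklore] -/
theorem shell_radial_integral_pos (k : ℕ) : 0 < ∫ r in (1 / 2 : ℝ)..2, r ^ k :=
  intervalIntegral.intervalIntegral_pos_of_pos_on ((continuous_pow _).intervalIntegrable _ _)
    (fun r hr => pow_pos (by linarith [hr.1]) _) (by norm_num)

/-- **Smoothing of a bounded, compactly supported kernel on `E × S^{d-1}` in both variables.**
For `0 ≤ H ≤ M` measurable on `E × S^{d-1}` vanishing for `|z| > R₀` and `η > 0` there is a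
smooth `b ≥ 0` on `E × E`, bounded, vanishing for `|z| ≥ max R₀ 2 + 1`, whose restriction to
`E × S^{d-1}` is `η`-close to `H` in `L¹(dz dσ)`. Construction: extend `H` to the shell
`1/2 ≤ |y| ≤ 2` of `E × E` along rays, smooth there in `L¹(dz dy)`
(`exists_smooth_nonneg_approx`), and average back radially with the weight `r^{d-1}` (polar
coordinates, `lintegral_sphere_shell_le`). This is the regularisation "`qₙ ∈ C_0^∞(ℝ^d × S^{d-1})`,
`qₙ → q`" of CIP 1994 §5.3 Step 7 made explicit. [cite: CIPDiluteGases1994, §5.3 Step 7 (p. 146)] -/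
theorem exists_smooth_angular_approx {H : E × sphere (0 : E) 1 → ℝ} (hHm : Measurable H)
    (hH0 : ∀ q, 0 ≤ H q) {M : ℝ} (hHM : ∀ q, H q ≤ M) {R₀ : ℝ} (hR₀ : 0 < R₀)
    (hHsupp : ∀ q, R₀ < ‖q.1‖ → H q = 0) {η : ℝ} (hη : 0 < η) :
    ∃ b : E × E → ℝ, ContDiff ℝ ((⊤ : ℕ∞) : WithTop ℕ∞) b ∧ (∀ p, 0 ≤ b p) ∧
      (∀ p, b p ≤ max M 1 + 1) ∧ (∀ p, max R₀ 2 + 1 ≤ ‖p.1‖ → b p = 0) ∧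
      ∫⁻ q, ENNReal.ofReal |b (q.1, q.2) - H q| ∂((volume : Measure E).prod sphereMeasure) ≤
        ENNReal.ofReal η := by
  haveI := isFiniteMeasure_sphereMeasure (E := E)
  set d : ℕ := Module.finrank ℝ E with hd
  set c : ℝ := ∫ r in (1 / 2 : ℝ)..2, r ^ (d - 1) with hc
  have hcpos : 0 < c := shell_radial_integral_pos _
  obtain ⟨radialProj, measurable_radialProj, hproj⟩ := exists_measurable_radialProj (E := E)
  have radialProj_smul : ∀ {r : ℝ}, 0 < r → ∀ ω : sphere (0 : E) 1, radialProj (r • (ω : E)) = ω :=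
    fun hr ω => hproj _ hr ω
  set M' : ℝ := max M 1 with hM'
  set R : ℝ := max R₀ 2 with hR
  have hRpos : 0 < R := lt_max_of_lt_left hR₀
  -- the closed shell and the cone extension of `H`
  set shell : Set E := {y | 1 / 2 ≤ ‖y‖ ∧ ‖y‖ ≤ 2} with hshell
  have hshellm : MeasurableSet shell :=
    (measurableSet_le measurable_const measurable_norm).inter (measurableSet_le measurable_norm measurable_const)
  set T : E × E → ℝ := fun p => shell.indicator (fun _ => (1 : ℝ)) p.2 * H (p.1, radialProj p.2) with hT
  have hTm : Measurable T :=
    ((measurable_const.indicator hshellm).comp measurable_snd).mul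
      (hHm.comp (measurable_fst.prodMk (measurable_radialProj.comp measurable_snd)))
  have hT0 : ∀ p, 0 ≤ T p := fun p => mul_nonneg (indicator_nonneg (fun _ _ => zero_le_one) _) (hH0 _)
  have hTM : ∀ p, T p ≤ M' := fun p => by
    simp only [hT]
    by_cases hp : p.2 ∈ shell
    · rw [indicator_of_mem hp, one_mul]; exact (hHM _).trans (le_max_left _ _)
    · rw [indicator_of_notMem hp, zero_mul]; exact le_trans zero_le_one (le_max_right _ _)
  have hTsupp : ∀ p : E × E, R < ‖p‖ → T p = 0 := by
    intro p hp
    rw [Prod.norm_def] at hp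
    rcases lt_max_iff.1 hp with h1 | h2
    · simp only [hT, hHsupp (p.1, radialProj p.2) (lt_of_le_of_lt (le_max_left _ _) h1), mul_zero]
    · have : p.2 ∉ shell := fun h => by
        have := h.2; linarith [le_max_right R₀ 2]
      simp only [hT, indicator_of_notMem this, zero_mul]
  -- on rays through the sphere the extension is `H`
  have hTray : ∀ (z : E) (ω : sphere (0 : E) 1), ∀ r ∈ uIcc (1 / 2 : ℝ) 2, T (z, r • (ω : E)) = H (z, ω) := by
    intro z ω r hr
    rw [uIcc_of_le (by norm_num : (1 / 2 : ℝ) ≤ 2)] at hr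
    have hrpos : 0 < r := by linarith [hr.1]
    have hnorm : ‖r • (ω : E)‖ = r := by
      rw [norm_smul, Real.norm_eq_abs, abs_of_pos hrpos, norm_eq_of_mem_sphere, mul_one]
    have hmem : r • (ω : E) ∈ shell := by simp only [hshell, mem_setOf_eq, hnorm]; exact ⟨hr.1, hr.2⟩
    simp only [hT, indicator_of_mem hmem, one_mul, radialProj_smul hrpos]
  -- smoothing on `E × E`
  obtain ⟨S, hSs, -, hS0, hSM, hSsupp, hSTi, hST⟩ := exists_smooth_nonneg_approx
    ((volume : Measure E).prod volume) hTm (le_max_right M 1) hT0 hTM hRpos hTsupp (mul_pos hcpos hη)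
  -- the radial average
  set b : E × E → ℝ := fun p => c⁻¹ * ∫ r in (1 / 2 : ℝ)..2, S (p.1, r • p.2) * r ^ (d - 1) with hb
  have hSc : Continuous S := hSs.continuous
  refine ⟨b, ?_, ?_, ?_, ?_, ?_⟩
  · -- smoothness
    have hK : ContDiff ℝ ((⊤ : ℕ∞) : WithTop ℕ∞)
        (fun q : ℝ × (E × E) => S (q.2.1, q.1 • q.2.2) * q.1 ^ (d - 1)) :=
      (hSs.comp ((contDiff_fst.comp contDiff_snd).prodMk
        (contDiff_fst.smul (contDiff_snd.comp contDiff_snd)))).mul (contDiff_fst.pow _)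
    exact contDiff_const.mul (contDiff_parametric_intervalIntegral hK _ _)
  · -- nonnegativity
    intro p
    refine mul_nonneg (inv_nonneg.2 hcpos.le) (intervalIntegral.integral_nonneg (by norm_num) fun r hr => ?_)
    exact mul_nonneg (hS0 _) (pow_nonneg (by linarith [hr.1]) _)
  · -- the bound
    intro p
    have hle : ∫ r in (1 / 2 : ℝ)..2, S (p.1, r • p.2) * r ^ (d - 1) ≤
        ∫ r in (1 / 2 : ℝ)..2, (M' + 1) * r ^ (d - 1) := by
      refine intervalIntegral.integral_mono_on (by norm_num) ?_ ?_ fun r hr => ?_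
      · exact ((hSc.comp (continuous_const.prodMk (continuous_id.smul continuous_const))).mul
          (continuous_pow _)).intervalIntegrable _ _
      · exact (continuous_const.mul (continuous_pow _)).intervalIntegrable _ _
      · exact mul_le_mul_of_nonneg_right (hSM _) (pow_nonneg (by linarith [hr.1]) _)
    rw [intervalIntegral.integral_const_mul] at hle
    calc b p ≤ c⁻¹ * ((M' + 1) * c) := mul_le_mul_of_nonneg_left hle (inv_nonneg.2 hcpos.le)
      _ = M' + 1 := by field_simp
  · -- support in `z`
    intro p hp
    have h0 : ∀ r : ℝ, S (p.1, r • p.2) = 0 := fun r => by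
      refine hSsupp _ (hp.trans ?_)
      rw [Prod.norm_def]; exact le_max_left _ _
    simp only [hb, h0, zero_mul, intervalIntegral.integral_zero, mul_zero]
  · -- the `L¹` estimate; Step A: pointwise on rays
    have hk0 : ∀ r ∈ uIcc (1 / 2 : ℝ) 2, (0 : ℝ) ≤ r ^ (d - 1) := fun r hr => by
      rw [uIcc_of_le (by norm_num : (1 / 2 : ℝ) ≤ 2)] at hr
      exact pow_nonneg (by linarith [hr.1]) _
    have hA : ∀ (z : E) (ω : sphere (0 : E) 1), ENNReal.ofReal |b (z, ω) - H (z, ω)| ≤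
        ENNReal.ofReal c⁻¹ * ∫⁻ r in Ioo (1 / 2 : ℝ) 2, ENNReal.ofReal (r ^ (d - 1)) *
          ENNReal.ofReal |S (z, r • (ω : E)) - T (z, r • (ω : E))| := by
      intro z ω
      have hcontS : Continuous fun r : ℝ => S (z, r • (ω : E)) :=
        hSc.comp (continuous_const.prodMk (continuous_id.smul continuous_const))
      have hI : ∀ {g : ℝ → ℝ}, Continuous g → IntervalIntegrable g volume (1 / 2 : ℝ) 2 :=
        fun hg => hg.intervalIntegrable _ _
      -- `b - H = c⁻¹ ∫ (S(rω) - H) r^{d-1}`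
      have hdiff : b (z, ω) - H (z, ω) =
          c⁻¹ * ∫ r in (1 / 2 : ℝ)..2, (S (z, r • (ω : E)) - H (z, ω)) * r ^ (d - 1) := by
        have hsub : ∫ r in (1 / 2 : ℝ)..2, (S (z, r • (ω : E)) - H (z, ω)) * r ^ (d - 1) =
            (∫ r in (1 / 2 : ℝ)..2, S (z, r • (ω : E)) * r ^ (d - 1)) -
              ∫ r in (1 / 2 : ℝ)..2, H (z, ω) * r ^ (d - 1) := by
          rw [← intervalIntegral.integral_sub
            (hI (g := fun r => S (z, r • (ω : E)) * r ^ (d - 1)) (hcontS.mul (continuous_pow _)))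
            (hI (g := fun r => H (z, ω) * r ^ (d - 1)) (continuous_const.mul (continuous_pow _)))]
          refine intervalIntegral.integral_congr fun r _ => ?_
          ring
        rw [hsub, intervalIntegral.integral_const_mul, ← hc]
        simp only [hb]
        field_simp
      -- `|b - H| ≤ c⁻¹ ∫ |S(rω) - H| r^{d-1}`
      have habs : |b (z, ω) - H (z, ω)| ≤
          c⁻¹ * ∫ r in (1 / 2 : ℝ)..2, |S (z, r • (ω : E)) - H (z, ω)| * r ^ (d - 1) := by
        rw [hdiff, abs_mul, abs_of_pos (inv_pos.2 hcpos)]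
        refine mul_le_mul_of_nonneg_left ?_ (inv_nonneg.2 hcpos.le)
        refine (intervalIntegral.abs_integral_le_integral_abs (by norm_num)).trans (le_of_eq ?_)
        refine intervalIntegral.integral_congr fun r hr => ?_
        simp only [abs_mul, abs_of_nonneg (hk0 r hr)]
      -- as a lower integral over the open interval, with `H = T` on the rays
      have hint : IntegrableOn (fun r : ℝ => |S (z, r • (ω : E)) - H (z, ω)| * r ^ (d - 1)) (Ioc (1 / 2 : ℝ) 2) :=
        (((hcontS.sub continuous_const).abs.mul (continuous_pow _)).integrableOn_Icc).mono_set
          Ioc_subset_Icc_self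
      calc ENNReal.ofReal |b (z, ω) - H (z, ω)|
          ≤ ENNReal.ofReal (c⁻¹ * ∫ r in (1 / 2 : ℝ)..2, |S (z, r • (ω : E)) - H (z, ω)| * r ^ (d - 1)) :=
            ENNReal.ofReal_le_ofReal habs
        _ = ENNReal.ofReal c⁻¹ * ∫⁻ r in Ioc (1 / 2 : ℝ) 2,
              ENNReal.ofReal (|S (z, r • (ω : E)) - H (z, ω)| * r ^ (d - 1)) := by
            rw [ENNReal.ofReal_mul (inv_nonneg.2 hcpos.le), intervalIntegral.integral_of_le (by norm_num),
              ofReal_integral_eq_lintegral_ofReal hint]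
            exact (ae_restrict_mem measurableSet_Ioc).mono fun r hr =>
              mul_nonneg (abs_nonneg _) (pow_nonneg (by linarith [hr.1]) _)
        _ = ENNReal.ofReal c⁻¹ * ∫⁻ r in Ioo (1 / 2 : ℝ) 2,
              ENNReal.ofReal (|S (z, r • (ω : E)) - H (z, ω)| * r ^ (d - 1)) := by
            rw [setLIntegral_congr Ioo_ae_eq_Ioc]
        _ = _ := by
            congr 1
            refine setLIntegral_congr_fun measurableSet_Ioo fun r hr => ?_
            have hr' : r ∈ uIcc (1 / 2 : ℝ) 2 := by
              rw [uIcc_of_le (by norm_num : (1 / 2 : ℝ) ≤ 2)]; exact ⟨hr.1.le, hr.2.le⟩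
            rw [← hTray z ω r hr', ENNReal.ofReal_mul (abs_nonneg _), mul_comm]
    -- Step B: integrate over the sphere and use polar coordinates
    set G : E → E → ℝ≥0∞ := fun z y => ENNReal.ofReal |S (z, y) - T (z, y)| with hG
    have hGm2 : Measurable (Function.uncurry G) :=
      ((hSc.measurable.comp measurable_id).sub hTm).abs.ennreal_ofReal |>.comp
        (measurable_fst.prodMk measurable_snd)
    have hGm : ∀ z, Measurable (G z) := fun z => hGm2.comp (measurable_const.prodMk measurable_id)
    have hB : ∀ z : E, ∫⁻ ω, ENNReal.ofReal |b (z, ω) - H (z, ω)| ∂(sphereMeasure : Measure (sphere (0 : E) 1)) ≤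
        ENNReal.ofReal c⁻¹ * ∫⁻ y, G z y := by
      intro z
      calc ∫⁻ ω, ENNReal.ofReal |b (z, ω) - H (z, ω)| ∂(sphereMeasure : Measure (sphere (0 : E) 1))
          ≤ ∫⁻ ω, ENNReal.ofReal c⁻¹ * (∫⁻ r in Ioo (1 / 2 : ℝ) 2, ENNReal.ofReal (r ^ (d - 1)) *
              G z (r • (ω : E))) ∂(sphereMeasure : Measure (sphere (0 : E) 1)) := lintegral_mono fun ω => hA z ω
        _ = ENNReal.ofReal c⁻¹ * ∫⁻ ω, (∫⁻ r in Ioo (1 / 2 : ℝ) 2, ENNReal.ofReal (r ^ (d - 1)) *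
              G z (r • (ω : E))) ∂(sphereMeasure : Measure (sphere (0 : E) 1)) :=
            lintegral_const_mul' _ _ ENNReal.ofReal_ne_top
        _ ≤ ENNReal.ofReal c⁻¹ * ∫⁻ y, G z y :=
            mul_le_mul_of_nonneg_left (lintegral_sphere_shell_le (hGm z)) bot_le
    -- Step C: integrate over `z`
    have hbc : Continuous b := by
      have hK : ContDiff ℝ ((⊤ : ℕ∞) : WithTop ℕ∞)
          (fun q : ℝ × (E × E) => S (q.2.1, q.1 • q.2.2) * q.1 ^ (d - 1)) :=
        (hSs.comp ((contDiff_fst.comp contDiff_snd).prodMk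
          (contDiff_fst.smul (contDiff_snd.comp contDiff_snd)))).mul (contDiff_fst.pow _)
      exact (contDiff_const.mul (contDiff_parametric_intervalIntegral hK _ _)).continuous
    have hmeas : AEMeasurable (fun q : E × sphere (0 : E) 1 => ENNReal.ofReal |b (q.1, q.2) - H q|)
        ((volume : Measure E).prod sphereMeasure) := by
      refine Measurable.aemeasurable ?_
      have h1 : Measurable fun q : E × sphere (0 : E) 1 => b (q.1, q.2) :=
        hbc.measurable.comp (measurable_fst.prodMk (measurable_subtype_coe.comp measurable_snd))
      exact (h1.sub hHm).abs.ennreal_ofReal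
    calc ∫⁻ q, ENNReal.ofReal |b (q.1, q.2) - H q| ∂((volume : Measure E).prod sphereMeasure)
        = ∫⁻ z, ∫⁻ ω, ENNReal.ofReal |b (z, ω) - H (z, ω)| ∂(sphereMeasure : Measure (sphere (0 : E) 1)) :=
          lintegral_prod _ hmeas
      _ ≤ ∫⁻ z, ENNReal.ofReal c⁻¹ * ∫⁻ y, G z y := lintegral_mono hB
      _ = ENNReal.ofReal c⁻¹ * ∫⁻ p, ENNReal.ofReal |S p - T p| ∂((volume : Measure E).prod volume) := by
          rw [lintegral_const_mul' _ _ ENNReal.ofReal_ne_top, lintegral_prod _ ?_]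
          exact ((hSc.measurable.sub hTm).abs.ennreal_ofReal).aemeasurable
      _ = ENNReal.ofReal c⁻¹ * ENNReal.ofReal (∫ p, |S p - T p| ∂((volume : Measure E).prod volume)) := by
          rw [ofReal_integral_eq_lintegral_ofReal hSTi.abs (Eventually.of_forall fun p => abs_nonneg _)]
      _ ≤ ENNReal.ofReal c⁻¹ * ENNReal.ofReal (c * η) := mul_le_mul_of_nonneg_left (ENNReal.ofReal_le_ofReal hST) bot_le
      _ = ENNReal.ofReal η := by
          rw [← ENNReal.ofReal_mul (inv_nonneg.2 hcpos.le), ← mul_assoc, inv_mul_cancel₀ hcpos.ne', one_mul]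

end Smoothing

end Literature.MathematicalPhysics.KineticTheory
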